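import Summits.QuantumFields.YangMills.Theorems.SwapVirialDeficitZeroModeGroupThreeSmallBallRateLayers
import Summits.QuantumFields.YangMills.Theorems.SwapVirialDeficitZeroModeGroupThreeDominator
import HarnessLib

/-!
# Exact zero-mode rung Z4 in SMALL-BALL form — VII: flip arithmetic, the layer sets of `G_s(a) Δ G₀(a)` in pair coordinates, and the
# volumes of the ball/hub layers
# (LEAD ym-line-sfw-p2 g93 07:46Z «`Haar³{N₃(t)} = v₃t⁴(1 + O(t^θ))`»; free-hands support of ⟨stmt-QuantumFields-24197⟩)

In the pair coordinates `p = ((x₀,y₀),((x_I,y_I),((x_J,y_J),(x_K,y_K)))) = pairCoord (x,y)` (✓`ZeroModeGroup.pairCoord`, w2 g55):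
* §14 flip arithmetic: `flip_window`, `coupled_flip_pos/neg` (a disagreement of the coupled constraint between `s` and `0` forces
  `|4P − N₀(x)N₀(y)| ≤ s(X + Y + 4XY)`), `sq_mem_layer_of_abs_le` (a quadratic equation in `x₀` up to `δ` is a layer of width `2δ/α`);
* §15 definitions: `xT`, `yT`, `pC` (transverse squares, coupled form), the `window r` (`y₀², x_I², y_I² < 1`, the four transverse coordinates
  `< 1/(4r²)`), and the five layer sets `layerBX/HX/BY/HY/C`;
* §15b measurability, ★ `volume_window` (`= 8/r⁴`), and by part VI ★ `volume_layerXtype_le` / ★ `volume_layerYtype_le`: any measurable set whose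
  `x₀`- (resp. `y₀`-) sections over the window are layers of width `s·xT` (resp. `s·yT`) has volume `≤ (2√s/r)·(8/r⁴)`.
Parts VII-b/c: the coupled layer (separable singular weight), the inclusion `G_sΔG₀ ⊆ layers`, the per-hub bound; part VIII: the rate.
HONEST LABEL: finite-dimensional measure theory (plan-level zero-mode rung of a DRAFT line); NOT ⟨24197⟩; the Yang–Mills mass gap is NOT proved; no summit
is proved by a line.  Seat ym-line-fcl-p3 g44, `--supports stmt-QuantumFields-24197`.  Definitions + theorems, standard axioms.
References: [cite: GonzalezarroyoAltes1988]; [cite: Vanbaal2001]; [folklore].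
-/

set_option autoImplicit false

noncomputable section

open MeasureTheory Quaternion Set Filter Topology
open scoped Quaternion ENNReal BigOperators Topology
open Literature.MathematicalPhysics.QuantumLattice
open Summit.QuantumFields.YangMills.Theorems.SwapTwistDeficit.ToronLog

attribute [local instance] Literature.Analysis.FluidPDE.Tao2016.quatMeasurableSpace
  Literature.Analysis.FluidPDE.Tao2016.quatBorelSpace
  Literature.MathematicalPhysics.QuantumLattice.secondCountableTopology_su2

namespace Summit.QuantumFields.YangMills.Theorems.SwapVirialDeficit.ZeroModeGroup

/-! ## §14 Flip arithmetic -/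

/-- **Ball/hub flip**: if `A ≤ B` fails but `A ≤ B + s·X` holds (`s·X ≥ 0`), then `B < A ≤ B + sX`. [folklore] -/
theorem flip_window {A B E : ℝ} (h0 : ¬A ≤ B) (hs : A ≤ B + E) : B ≤ A ∧ A ≤ B + E := ⟨le_of_lt (not_le.1 h0), hs⟩

/-- **Coupled flip**, direction `s ✓ / 0 ✗`: from `4(P + sQ) ≤ (Nx + sX)(Ny + sY)`, `¬ 4P ≤ Nx·Ny`, `0 ≤ Q`, `Nx, Ny ≤ 1`, `0 ≤ s ≤ 1`, `X, Y ≥ 0`: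
`|4P − Nx·Ny| ≤ s(X + Y + X·Y)`. [folklore] -/
theorem coupled_flip_pos {P Q Nx Ny X Y s : ℝ} (hs0 : 0 ≤ s) (hs1 : s ≤ 1) (hQ : 0 ≤ Q) (hX : 0 ≤ X) (hY : 0 ≤ Y)
    (hNx : Nx ≤ 1) (hNy : Ny ≤ 1)
    (hS : 4 * (P + s * Q) ≤ (Nx + s * X) * (Ny + s * Y)) (h0 : ¬4 * P ≤ Nx * Ny) :
    |4 * P - Nx * Ny| ≤ s * (X + Y + 4 * (X * Y)) := by
  have h1 : Nx * Ny < 4 * P := not_le.1 h0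
  rw [abs_of_pos (by linarith)]
  have hss : s * s ≤ s := by nlinarith
  have hXY : s * s * (X * Y) ≤ s * (X * Y) := mul_le_mul_of_nonneg_right hss (mul_nonneg hX hY)
  have hA : s * Nx * Y ≤ s * Y := by nlinarith [mul_nonneg (mul_nonneg hs0 hY) (sub_nonneg.2 hNx)]
  have hB : s * Ny * X ≤ s * X := by nlinarith [mul_nonneg (mul_nonneg hs0 hX) (sub_nonneg.2 hNy)]
  have hQ' : 0 ≤ s * Q := mul_nonneg hs0 hQ
  have hXY0 : 0 ≤ s * (X * Y) := mul_nonneg hs0 (mul_nonneg hX hY)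
  nlinarith

/-- **Coupled flip**, direction `0 ✓ / s ✗`: from `4P ≤ Nx·Ny`, `¬ 4(P + sQ) ≤ (Nx + sX)(Ny + sY)`, `Q ≤ X·Y`, …: `|4P − Nx·Ny| ≤ s(X + Y + 4XY)`. [folklore] -/
theorem coupled_flip_neg {P Q Nx Ny X Y s : ℝ} (hs0 : 0 ≤ s) (hQXY : Q ≤ X * Y) (hX : 0 ≤ X) (hY : 0 ≤ Y)
    (hNx0 : 0 ≤ Nx) (hNy0 : 0 ≤ Ny)
    (h0 : 4 * P ≤ Nx * Ny) (hS : ¬4 * (P + s * Q) ≤ (Nx + s * X) * (Ny + s * Y)) :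
    |4 * P - Nx * Ny| ≤ s * (X + Y + 4 * (X * Y)) := by
  have h1 : (Nx + s * X) * (Ny + s * Y) < 4 * (P + s * Q) := not_le.1 hS
  rw [abs_of_nonpos (by linarith)]
  have hsQ : s * Q ≤ s * (X * Y) := mul_le_mul_of_nonneg_left hQXY hs0
  have hA : 0 ≤ s * (Nx * Y) := mul_nonneg hs0 (mul_nonneg hNx0 hY)
  have hB : 0 ≤ s * (Ny * X) := mul_nonneg hs0 (mul_nonneg hNy0 hX)
  have hC : 0 ≤ s * s * (X * Y) := mul_nonneg (mul_nonneg hs0 hs0) (mul_nonneg hX hY)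
  nlinarith

/-- From `|αx₀² − γ| ≤ δ` with `α > 0`: `x₀² ∈ [γ/α − δ/α, (γ/α − δ/α) + 2δ/α]`. [folklore] -/
theorem sq_mem_layer_of_abs_le {α γ δ u : ℝ} (hα : 0 < α) (h : |α * u ^ 2 - γ| ≤ δ) :
    γ / α - δ / α ≤ u ^ 2 ∧ u ^ 2 ≤ γ / α - δ / α + 2 * δ / α := by
  obtain ⟨h1, h2⟩ := abs_le.1 h
  constructor
  · rw [← sub_div, div_le_iff₀ hα]; linarith
  · rw [show γ / α - δ / α + 2 * δ / α = (γ + δ) / α by ring, le_div_iff₀ hα]; linarith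

/-! ## §15 The layer sets in the pair coordinates -/

/-- Shorthand type of the «rest» coordinates `w = ((x_I,y_I),((x_J,y_J),(x_K,y_K)))`: transverse squares and the coupled form, as functions of
`q = (y₀, w)` where convenient.  `xT w = x_J² + x_K²`. [folklore] -/
def xT (w : (ℝ × ℝ) × ((ℝ × ℝ) × (ℝ × ℝ))) : ℝ := w.2.1.1 ^ 2 + w.2.2.1 ^ 2

/-- `yT w = y_J² + y_K²`. [folklore] -/
def yT (w : (ℝ × ℝ) × ((ℝ × ℝ) × (ℝ × ℝ))) : ℝ := w.2.1.2 ^ 2 + w.2.2.2 ^ 2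

/-- The coupled form `P = (x_K y_I − x_I y_K)² + (x_I y_J − x_J y_I)²`. [folklore] -/
def pC (w : (ℝ × ℝ) × ((ℝ × ℝ) × (ℝ × ℝ))) : ℝ := (w.2.2.1 * w.1.2 - w.1.1 * w.2.2.2) ^ 2 + (w.1.1 * w.2.1.2 - w.2.1.1 * w.1.2) ^ 2

/-- The window: `y₀² < 1`, `x_I², y_I² < 1`, `x_J², y_J², x_K², y_K² < 1/(4r²)` — every point of `G_s ∪ G₀` projects into it. [folklore] -/
def window (r : ℝ) : Set (ℝ × ((ℝ × ℝ) × ((ℝ × ℝ) × (ℝ × ℝ)))) :=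
  {u : ℝ | u ^ 2 < 1} ×ˢ (({u : ℝ | u ^ 2 < 1} ×ˢ {u : ℝ | u ^ 2 < 1}) ×ˢ
    (({u : ℝ | u ^ 2 < 1 / (4 * r ^ 2)} ×ˢ {u : ℝ | u ^ 2 < 1 / (4 * r ^ 2)}) ×ˢ
      ({u : ℝ | u ^ 2 < 1 / (4 * r ^ 2)} ×ˢ {u : ℝ | u ^ 2 < 1 / (4 * r ^ 2)})))

/-- Layer of the `x`-ball flip: window and `1 − x_I² − s·xT ≤ x₀² ≤ 1 − x_I²` (within `s·xT`). [folklore] -/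
def layerBX (r s : ℝ) : Set ((ℝ × ℝ) × ((ℝ × ℝ) × ((ℝ × ℝ) × (ℝ × ℝ)))) :=
  {p | (p.1.2, p.2) ∈ window r ∧ 1 - p.2.1.1 ^ 2 - s * xT p.2 ≤ p.1.1 ^ 2 ∧ p.1.1 ^ 2 ≤ 1 - p.2.1.1 ^ 2 - s * xT p.2 + s * xT p.2}

/-- Layer of the `x`-hub flip: window and `4r²xT/ρ² − x_I² − s·xT ≤ x₀² ≤ 4r²xT/ρ² − x_I²`. [folklore] -/
def layerHX (r ρ s : ℝ) : Set ((ℝ × ℝ) × ((ℝ × ℝ) × ((ℝ × ℝ) × (ℝ × ℝ)))) :=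
  {p | (p.1.2, p.2) ∈ window r ∧ 4 * r ^ 2 * xT p.2 / ρ ^ 2 - p.2.1.1 ^ 2 - s * xT p.2 ≤ p.1.1 ^ 2 ∧
    p.1.1 ^ 2 ≤ 4 * r ^ 2 * xT p.2 / ρ ^ 2 - p.2.1.1 ^ 2 - s * xT p.2 + s * xT p.2}

/-- Layer of the `y`-ball flip (roles of `x₀`, `y₀` exchanged; window on `(x₀, w)`). [folklore] -/
def layerBY (r s : ℝ) : Set ((ℝ × ℝ) × ((ℝ × ℝ) × ((ℝ × ℝ) × (ℝ × ℝ)))) :=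
  {p | (p.1.1, p.2) ∈ window r ∧ 1 - p.2.1.2 ^ 2 - s * yT p.2 ≤ p.1.2 ^ 2 ∧ p.1.2 ^ 2 ≤ 1 - p.2.1.2 ^ 2 - s * yT p.2 + s * yT p.2}

/-- Layer of the `y`-hub flip. [folklore] -/
def layerHY (r ρ s : ℝ) : Set ((ℝ × ℝ) × ((ℝ × ℝ) × ((ℝ × ℝ) × (ℝ × ℝ)))) :=
  {p | (p.1.1, p.2) ∈ window r ∧ 4 * r ^ 2 * yT p.2 / ρ ^ 2 - p.2.1.2 ^ 2 - s * yT p.2 ≤ p.1.2 ^ 2 ∧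
    p.1.2 ^ 2 ≤ 4 * r ^ 2 * yT p.2 / ρ ^ 2 - p.2.1.2 ^ 2 - s * yT p.2 + s * yT p.2}

/-- Layer of the coupled flip: window, `0 < y₀² + y_I²`, and `x₀²` within `2s·r⁻⁴/(y₀² + y_I²)` of `(4P − x_I²(y₀²+y_I²) − s·r⁻⁴)/(y₀²+y_I²)`.
[folklore] -/
def layerC (r s : ℝ) : Set ((ℝ × ℝ) × ((ℝ × ℝ) × ((ℝ × ℝ) × (ℝ × ℝ)))) :=
  {p | (p.1.2, p.2) ∈ window r ∧ 0 < p.1.2 ^ 2 + p.2.1.2 ^ 2 ∧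
    (4 * pC p.2 / (p.1.2 ^ 2 + p.2.1.2 ^ 2) - (s * (r ^ 4)⁻¹) / (p.1.2 ^ 2 + p.2.1.2 ^ 2) - p.2.1.1 ^ 2) ≤ p.1.1 ^ 2 ∧
    p.1.1 ^ 2 ≤ (4 * pC p.2 / (p.1.2 ^ 2 + p.2.1.2 ^ 2) - (s * (r ^ 4)⁻¹) / (p.1.2 ^ 2 + p.2.1.2 ^ 2) - p.2.1.1 ^ 2) +
      2 * (s * (r ^ 4)⁻¹) / (p.1.2 ^ 2 + p.2.1.2 ^ 2)}


/-! ## §15b Measurability and the window volume -/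

/-- Coordinate polynomials on the rest space are measurable. [folklore] -/
theorem measurable_xT : Measurable xT := by unfold xT; fun_prop

/-- `yT` is measurable. [folklore] -/
theorem measurable_yT : Measurable yT := by unfold yT; fun_prop

/-- `pC` is measurable. [folklore] -/
theorem measurable_pC : Measurable pC := by unfold pC; fun_prop

/-- `{u | u² < c}` is measurable. [folklore] -/
theorem measurableSet_sqLt (c : ℝ) : MeasurableSet {u : ℝ | u ^ 2 < c} := measurableSet_lt (measurable_id.pow_const 2) measurable_const

/-- The window is measurable. [folklore] -/
theorem measurableSet_window (r : ℝ) : MeasurableSet (window r) :=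
  (measurableSet_sqLt 1).prod (((measurableSet_sqLt 1).prod (measurableSet_sqLt 1)).prod
    (((measurableSet_sqLt _).prod (measurableSet_sqLt _)).prod ((measurableSet_sqLt _).prod (measurableSet_sqLt _))))

/-- `vol{u | u² < R²} = 2R` for `R > 0`, here with `R = 1/(2r)`: `vol{u | u² < 1/(4r²)} = 1/r`. [folklore] -/
theorem volume_sqLt_quarter {r : ℝ} (hr : 0 < r) : (volume : Measure ℝ) {u : ℝ | u ^ 2 < 1 / (4 * r ^ 2)} = ENNReal.ofReal (1 / r) := by
  have e : {u : ℝ | u ^ 2 < 1 / (4 * r ^ 2)} = Set.Ioo (-(1 / (2 * r))) (1 / (2 * r)) := by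
    ext u
    simp only [Set.mem_setOf_eq, Set.mem_Ioo]
    have h4 : 1 / (4 * r ^ 2) = (1 / (2 * r)) ^ 2 := by field_simp; ring
    rw [h4, sq_lt_sq, abs_of_pos (by positivity : (0 : ℝ) < 1 / (2 * r)), abs_lt]
  rw [e, Real.volume_Ioo]
  congr 1
  field_simp
  ring

/-- ★ `vol(window r) = 8/r⁴` (`r > 0`). [folklore] -/
theorem volume_window {r : ℝ} (hr : 0 < r) :
    (volume : Measure (ℝ × ((ℝ × ℝ) × ((ℝ × ℝ) × (ℝ × ℝ))))) (window r) = ENNReal.ofReal (8 / r ^ 4) := by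
  rw [window]
  simp only [Measure.volume_eq_prod, Measure.prod_prod, volume_sqBox_one, volume_sqLt_quarter hr]
  have h1 : (0 : ℝ) ≤ 1 / r := by positivity
  have e8 : ENNReal.ofReal (8 / r ^ 4) =
      2 * (2 * 2 * (ENNReal.ofReal (1 / r) * ENNReal.ofReal (1 / r) * (ENNReal.ofReal (1 / r) * ENNReal.ofReal (1 / r)))) := by
    rw [← ENNReal.ofReal_mul h1, ← ENNReal.ofReal_mul (by positivity), show (2 : ℝ≥0∞) = ENNReal.ofReal 2 by simp,
      ← ENNReal.ofReal_mul (by norm_num), ← ENNReal.ofReal_mul (by positivity), ← ENNReal.ofReal_mul (by norm_num)]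
    congr 1; field_simp; ring
  rw [e8]

/-- On the window, `xT < 1/(2r²)` and hence `2√(s·xT) ≤ 2√s/r` (`r > 0`, `s ≥ 0`). [folklore] -/
theorem two_sqrt_mul_xT_le {r s : ℝ} (hr : 0 < r) (hs : 0 ≤ s) {q : ℝ × ((ℝ × ℝ) × ((ℝ × ℝ) × (ℝ × ℝ)))} (hq : q ∈ window r) :
    2 * Real.sqrt (s * xT q.2) ≤ 2 * Real.sqrt s / r := by
  obtain ⟨-, -, ⟨hJ, -⟩, ⟨hK, -⟩⟩ := hq
  simp only [Set.mem_setOf_eq] at hJ hK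
  have hx : xT q.2 ≤ 1 / r ^ 2 := by
    unfold xT
    have h2 : 1 / (4 * r ^ 2) + 1 / (4 * r ^ 2) = 1 / (2 * r ^ 2) := by field_simp; ring
    have h3 : 1 / (2 * r ^ 2) ≤ 1 / r ^ 2 := one_div_le_one_div_of_le (by positivity) (by nlinarith [sq_nonneg r])
    linarith
  have h1 : Real.sqrt (s * xT q.2) ≤ Real.sqrt s / r := by
    rw [show Real.sqrt s / r = Real.sqrt (s * (1 / r ^ 2)) by
      rw [Real.sqrt_mul hs, Real.sqrt_div' _ (sq_nonneg r), Real.sqrt_one, Real.sqrt_sq hr.le]; ring]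
    exact Real.sqrt_le_sqrt (mul_le_mul_of_nonneg_left hx hs)
  rw [mul_div_assoc]; linarith

/-- The same for `yT`. [folklore] -/
theorem two_sqrt_mul_yT_le {r s : ℝ} (hr : 0 < r) (hs : 0 ≤ s) {q : ℝ × ((ℝ × ℝ) × ((ℝ × ℝ) × (ℝ × ℝ)))} (hq : q ∈ window r) :
    2 * Real.sqrt (s * yT q.2) ≤ 2 * Real.sqrt s / r := by
  obtain ⟨-, -, ⟨-, hJ⟩, ⟨-, hK⟩⟩ := hq
  simp only [Set.mem_setOf_eq] at hJ hK
  have hx : yT q.2 ≤ 1 / r ^ 2 := by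
    unfold yT
    have h2 : 1 / (4 * r ^ 2) + 1 / (4 * r ^ 2) = 1 / (2 * r ^ 2) := by field_simp; ring
    have h3 : 1 / (2 * r ^ 2) ≤ 1 / r ^ 2 := one_div_le_one_div_of_le (by positivity) (by nlinarith [sq_nonneg r])
    linarith
  have h1 : Real.sqrt (s * yT q.2) ≤ Real.sqrt s / r := by
    rw [show Real.sqrt s / r = Real.sqrt (s * (1 / r ^ 2)) by
      rw [Real.sqrt_mul hs, Real.sqrt_div' _ (sq_nonneg r), Real.sqrt_one, Real.sqrt_sq hr.le]; ring]
    exact Real.sqrt_le_sqrt (mul_le_mul_of_nonneg_left hx hs)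
  rw [mul_div_assoc]; linarith

/-- ★ **Volume of an `X`-type layer**: a measurable `T` whose points have `(y₀,w)` in the window and `x₀²` in a layer of width `s·xT` has
`vol(T) ≤ (2√s/r)·(8/r⁴)`. [folklore] -/
theorem volume_layerXtype_le {r s : ℝ} (hr : 0 < r) (hs : 0 ≤ s) {T : Set ((ℝ × ℝ) × ((ℝ × ℝ) × ((ℝ × ℝ) × (ℝ × ℝ))))}
    (hT : MeasurableSet T) (g : ℝ × ((ℝ × ℝ) × ((ℝ × ℝ) × (ℝ × ℝ))) → ℝ)
    (hmem : ∀ (x₀ y₀ : ℝ) (w : (ℝ × ℝ) × ((ℝ × ℝ) × (ℝ × ℝ))), ((x₀, y₀), w) ∈ T →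
      (y₀, w) ∈ window r ∧ g (y₀, w) ≤ x₀ ^ 2 ∧ x₀ ^ 2 ≤ g (y₀, w) + s * xT w) :
    (volume : Measure ((ℝ × ℝ) × ((ℝ × ℝ) × ((ℝ × ℝ) × (ℝ × ℝ))))) T ≤ ENNReal.ofReal (2 * Real.sqrt s / r) * ENNReal.ofReal (8 / r ^ 4) := by
  have hF : Measurable fun q : ℝ × ((ℝ × ℝ) × ((ℝ × ℝ) × (ℝ × ℝ))) =>
      (window r).indicator (fun q => ENNReal.ofReal (2 * Real.sqrt (s * xT q.2))) q := by
    refine Measurable.indicator ?_ (measurableSet_window r)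
    exact ENNReal.measurable_ofReal.comp (measurable_const.mul (Real.continuous_sqrt.measurable.comp (measurable_const.mul (measurable_xT.comp measurable_snd))))
  refine (volume_coordLayer_le_lintegral hT (W := window r) g (fun q => s * xT q.2) (fun q => mul_nonneg hs (by unfold xT; positivity))
    hmem hF).trans ?_
  calc ∫⁻ q, (window r).indicator (fun q => ENNReal.ofReal (2 * Real.sqrt (s * xT q.2))) q ∂((volume : Measure ℝ).prod volume)
      ≤ ∫⁻ q, (window r).indicator (fun _ => ENNReal.ofReal (2 * Real.sqrt s / r)) q ∂((volume : Measure ℝ).prod volume) := by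
        refine lintegral_mono fun q => ?_
        by_cases hq : q ∈ window r
        · rw [Set.indicator_of_mem hq, Set.indicator_of_mem hq]
          exact ENNReal.ofReal_le_ofReal (two_sqrt_mul_xT_le hr hs hq)
        · rw [Set.indicator_of_notMem hq, Set.indicator_of_notMem hq]
    _ = ENNReal.ofReal (2 * Real.sqrt s / r) * ENNReal.ofReal (8 / r ^ 4) := by
        rw [lintegral_indicator_const (measurableSet_window r), ← volume_window hr]
        rfl

/-- ★ **Volume of a `Y`-type layer** (the `y₀`-coordinate in the layer, window on `(x₀, w)`): same bound. [folklore] -/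
theorem volume_layerYtype_le {r s : ℝ} (hr : 0 < r) (hs : 0 ≤ s) {T : Set ((ℝ × ℝ) × ((ℝ × ℝ) × ((ℝ × ℝ) × (ℝ × ℝ))))}
    (hT : MeasurableSet T) (g : ℝ × ((ℝ × ℝ) × ((ℝ × ℝ) × (ℝ × ℝ))) → ℝ)
    (hmem : ∀ (x₀ y₀ : ℝ) (w : (ℝ × ℝ) × ((ℝ × ℝ) × (ℝ × ℝ))), ((x₀, y₀), w) ∈ T →
      (x₀, w) ∈ window r ∧ g (x₀, w) ≤ y₀ ^ 2 ∧ y₀ ^ 2 ≤ g (x₀, w) + s * yT w) :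
    (volume : Measure ((ℝ × ℝ) × ((ℝ × ℝ) × ((ℝ × ℝ) × (ℝ × ℝ))))) T ≤ ENNReal.ofReal (2 * Real.sqrt s / r) * ENNReal.ofReal (8 / r ^ 4) := by
  have hF : Measurable fun q : ℝ × ((ℝ × ℝ) × ((ℝ × ℝ) × (ℝ × ℝ))) =>
      (window r).indicator (fun q => ENNReal.ofReal (2 * Real.sqrt (s * yT q.2))) q := by
    refine Measurable.indicator ?_ (measurableSet_window r)
    exact ENNReal.measurable_ofReal.comp (measurable_const.mul (Real.continuous_sqrt.measurable.comp (measurable_const.mul (measurable_yT.comp measurable_snd))))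
  refine (volume_coordLayer_le' hT (W := window r) g (fun q => s * yT q.2) (fun q => mul_nonneg hs (by unfold yT; positivity))
    hmem hF).trans ?_
  calc ∫⁻ q, (window r).indicator (fun q => ENNReal.ofReal (2 * Real.sqrt (s * yT q.2))) q ∂((volume : Measure ℝ).prod volume)
      ≤ ∫⁻ q, (window r).indicator (fun _ => ENNReal.ofReal (2 * Real.sqrt s / r)) q ∂((volume : Measure ℝ).prod volume) := by
        refine lintegral_mono fun q => ?_
        by_cases hq : q ∈ window r
        · rw [Set.indicator_of_mem hq, Set.indicator_of_mem hq]
          exact ENNReal.ofReal_le_ofReal (two_sqrt_mul_yT_le hr hs hq)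
        · rw [Set.indicator_of_notMem hq, Set.indicator_of_notMem hq]
    _ = ENNReal.ofReal (2 * Real.sqrt s / r) * ENNReal.ofReal (8 / r ^ 4) := by
        rw [lintegral_indicator_const (measurableSet_window r), ← volume_window hr]
        rfl


end Summit.QuantumFields.YangMills.Theorems.SwapVirialDeficit.ZeroModeGroup

end
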